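import Mathlib
import Literature.NumberTheory.LFunctions.Zhang2022.Section7aStatements
import Literature.NumberTheory.LFunctions.Zhang2022.Section7Eq73Edge
import Literature.NumberTheory.LFunctions.Zhang2022.Section7Eq75Discharge
import HarnessLib

/-!
# Zhang (2022) §7, (7.3) HOLDS: the «initial steps» of the proof of Proposition 7.1, closed in the kernel

Topic `Literature/NumberTheory/LFunctions/Zhang2022` (Landau–Siegel adjudication tree; verdict-neutral).
Y. Zhang, *Discrete mean estimates and the Landau–Siegel zero*, arXiv:2211.02515v1 (2022)
[Zhang2022LandauSiegel] — **an unrefereed manuscript under adjudication; nothing here asserts its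
Theorems 1–2 or anything about Landau–Siegel zeros.** Cell siegel-zhang (D-0069), typer seat L2-t2.

The typed deduction node `Section7aStatements.DedEq73 c′` («(7.3) follows from §7.u013–u018, (7.4),
(7.5)», kernel edge `Section7Eq73Edge.dedEq73_holds`, sz-d18) is fed with the kernel proofs of all
its leaves: `step7u013_holds`, `step7u014_holds`, `step7u015_holds`, `step7u016_holds`, `eq74_holds`,
`step7u017_holds`, `step7u018_holds` (this seat, `Section7aStatements`) and `Section7Eq75.eq75_holds`
((7.5), sz-d18, from Prop. 2.1 = Lemmas 3.4–3.6 in the tree). Hence **(7.3) is a theorem**: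
for all `𝐚₁, 𝐚₂` obeying (7.2), `Σ_{ψ∈Ψ₂} ∫_{𝔍(1)} 𝒞(s,ψ)A(𝐚₁;s,ψ)A(𝐚₂;1−s,ψ̄)ω(s) ds = o(𝔓)`
under Assumption (A) — exactly as typed (`Eq73 c′`, every real `c′`).

No definitions, no new named facts, no `sorry`. WHAT THIS IS NOT: any claim about Proposition 7.1
itself ((7.10)–(7.11) are other seats' nodes), Theorems 1–2, or Landau–Siegel zeros.

## References

* Y. Zhang, arXiv:2211.02515v1 (2022), §7 (7.3) p. 34, tex L1856–L1910.
  [cite: Zhang2022LandauSiegel, §7 (7.3) p.34]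
-/

noncomputable section

namespace Literature.NumberTheory.LFunctions.Zhang2022.Section7aStatements

/-- **`Z22:(7.3)` HOLDS** (p. 34, tex L1860): for every `B`, every `ε > 0`, all large `D`, under
Assumption (A), and all `𝐚₁, 𝐚₂` obeying (7.2) with bound `B`,
`|Σ_{ψ∈Ψ₂} ∫_{𝔍(1)} 𝒞(s,ψ)A(𝐚₁;s,ψ)A(𝐚₂;1−s,ψ̄)ω(s) ds| ≤ ε𝔓` — the composition of the kernel edge
`Section7Eq73Edge.dedEq73_holds` with the kernel proofs of its eight leaves. Kernel-checked;
0 new facts. [cite: Zhang2022LandauSiegel, §7 (7.3) p.34, tex L1856–L1910] -/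
theorem eq73_holds (c' : ℝ) : Eq73 c' :=
  Section7Eq73Edge.dedEq73_holds c' (step7u013_holds c') (step7u014_holds c') (step7u015_holds c')
    step7u016_holds eq74_holds (step7u017_holds c') (step7u018_holds c') (Section7Eq75.eq75_holds c')

variable (c' : ℝ) in
/-- `Eq73` — `_holds` alias of `eq73_holds` above under the fact's exact name, stated under the
prover's own binders as section variables (appended 2026-08-28, D-0026 bookkeeping: the proof term is the
existing theorem of this file; no statement, definition or attribute is edited; no new named fact; the
ledger's debt table listed the fact unproved). [cite: Zhang2022LandauSiegel, §7 (7.3) p.34, tex L1856–L1910] -/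
theorem _root_.Literature.NumberTheory.LFunctions.Zhang2022.Section7aStatements.Eq73_holds :
    _root_.Literature.NumberTheory.LFunctions.Zhang2022.Section7aStatements.Eq73 c' :=
  _root_.Literature.NumberTheory.LFunctions.Zhang2022.Section7aStatements.eq73_holds (c' := c')

end Literature.NumberTheory.LFunctions.Zhang2022.Section7aStatements
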